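import Mathlib.Combinatorics.Nullstellensatz
import HarnessLib

/-!
# Separating linear forms with small natural coefficients

Topic `Literature/RingTheory/ZeroDimensional` (zero-dimensional algebra: finite sets of points,
shape lemma). For a finite set `V` of `N` points of `Kⁿ` (`K` a field of characteristic zero) there
is a linear form `ℓ = ∑ ℓ_i X_i` with NATURAL coefficients `ℓ_i ≤ N(N-1)` which is injective on `V`
("`ℓ` separates the points of `V`"). This is the first item of every geometric resolution /
rational univariate representation of a zero-dimensional variety (Krick–Pardo 1996, Prop. 27 (1)
"the linear form `ℓ` separates the points of `V`", as used by Bürgisser, TCS 235 (2000), proof of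
Thm. 4.5, p. 82; Rouillier 1999, §2; the usual counting is over the forms `X_1 + i X_2 + ⋯ + i^{n-1} X_n`,
`0 ≤ i ≤ (n-1) N(N-1)/2`). We prove it by the polynomial method: the product over ordered pairs
`z ≠ z'` of points of the linear forms `∑_i (z_i - z'_i) X_i` is a nonzero polynomial of degree
`≤ N(N-1)`, so Alon's Combinatorial Nullstellensatz (Mathlib) gives a non-root in the grid
`{0, …, N(N-1)}ⁿ`.

## Content (namespace `Literature.RingTheory.ZeroDimensional`, everything proved)

* `eval_linearFormPoly` — `∑_i C(a_i) X_i` evaluates to `∑_i a_i x_i`;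
* `exists_separating_linearForm` — the separating form with coefficients `≤ N(N-1)`.

## References

* T. Krick, L. M. Pardo, *A computational method for Diophantine approximation*, Progr. Math. 143
  (1996) 193–253, Prop. 27 (1) (via [Burgisser2000TCS], p. 82).
* P. Bürgisser, *Cook's versus Valiant's hypothesis*, TCS 235 (2000), proof of Thm. 4.5, p. 82.
* N. Alon, Combinatorial Nullstellensatz, Combin. Probab. Comput. 8 (1999), Thm. 1.2
  (Mathlib `MvPolynomial.combinatorial_nullstellensatz_exists_eval_nonzero`).
-/

noncomputable section

open MvPolynomial Finset

namespace Literature.RingTheory.ZeroDimensional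

variable {K : Type*} [Field K] {ι : Type*} [Fintype ι]

/-- The polynomial `∑_i C(a_i) X_i` evaluates at `x` to `∑_i a_i x_i`. [folklore] -/
theorem eval_linearFormPoly (a x : ι → K) :
    eval x (∑ i, C (a i) * X i : MvPolynomial ι K) = ∑ i, a i * x i := by
  rw [map_sum]
  simp only [map_mul, eval_C, eval_X]

/-- The polynomial `∑_i C(a_i) X_i` has total degree `≤ 1`. [folklore] -/
theorem totalDegree_linearFormPoly_le (a : ι → K) :
    (∑ i, C (a i) * X i : MvPolynomial ι K).totalDegree ≤ 1 := by
  refine (totalDegree_finsetSum _ _).trans (Finset.sup_le fun i _ => ?_)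
  exact (totalDegree_mul _ _).trans (by rw [totalDegree_C, totalDegree_X, zero_add])

/-- **A separating linear form with small natural coefficients.** For a finite set `V` of `N`
points of `Kⁿ`, `K` a field of characteristic zero, there is `ℓ : ι → ℕ` with `ℓ_i ≤ N(N-1)` such
that `z ↦ ∑_i ℓ_i z_i` is injective on `V` (Krick–Pardo 1996, Prop. 27 (1), as used in
Bürgisser 2000 TCS, p. 82: "the linear form `ℓ` separates the points of `V`"). Proof: the product
over ordered pairs `z ≠ z'` in `V` of `∑_i (z_i - z'_i) X_i` is a nonzero polynomial of total degree
`≤ N(N-1)`; a monomial of top degree and the Combinatorial Nullstellensatz on the grids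
`{0, …, m_i} ⊆ K` give a non-root with natural coordinates `ℓ_i ≤ m_i ≤ N(N-1)`.
[cite: Burgisser2000TCS, proof of Thm. 4.5 p. 82] -/
theorem exists_separating_linearForm [CharZero K] [DecidableEq ι] (V : Finset (ι → K)) :
    ∃ ℓ : ι → ℕ, (∀ i, ℓ i ≤ V.card * (V.card - 1)) ∧
      Set.InjOn (fun z : ι → K => ∑ i, (ℓ i : K) * z i) (V : Set (ι → K)) := by
  classical
  -- the linear forms attached to ordered pairs of distinct points, and their product
  set L : (ι → K) × (ι → K) → MvPolynomial ι K := fun p => ∑ i, C (p.1 i - p.2 i) * X i with hL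
  set P : MvPolynomial ι K := ∏ p ∈ V.offDiag, L p with hP
  have hLne : ∀ p ∈ V.offDiag, L p ≠ 0 := by
    intro p hp hzero
    obtain ⟨-, -, hne⟩ := Finset.mem_offDiag.1 hp
    apply hne
    funext i
    have h1 := congr_arg (eval fun j => if j = i then (1 : K) else 0) hzero
    rw [hL, eval_linearFormPoly, map_zero] at h1
    simp only [mul_ite, mul_one, mul_zero, Finset.sum_ite_eq', Finset.mem_univ, if_true] at h1
    exact sub_eq_zero.1 h1
  have hP0 : P ≠ 0 := by
    rw [hP]
    exact Finset.prod_ne_zero_iff.2 hLne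
  have hPdeg : P.totalDegree ≤ V.card * (V.card - 1) := by
    calc P.totalDegree ≤ ∑ p ∈ V.offDiag, (L p).totalDegree := totalDegree_finsetProd _ _
      _ ≤ ∑ p ∈ V.offDiag, 1 := Finset.sum_le_sum fun p _ => totalDegree_linearFormPoly_le _
      _ = V.card * (V.card - 1) := by
        rw [Finset.sum_const, smul_eq_mul, mul_one, Finset.offDiag_card, Nat.mul_sub_one]
  -- a monomial of top degree and the Combinatorial Nullstellensatz
  obtain ⟨m₀, hm₀, hdeg⟩ : ∃ m₀ ∈ P.support, P.totalDegree = m₀.degree :=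
    Finset.exists_mem_eq_sup P.support (support_nonempty.2 hP0) _
  set S : ι → Finset K := fun i => (Finset.range (m₀ i + 1)).image (Nat.cast : ℕ → K) with hS
  have hScard : ∀ i, m₀ i < #(S i) := fun i => by
    rw [hS, Finset.card_image_of_injective _ Nat.cast_injective, Finset.card_range]
    exact Nat.lt_succ_self _
  obtain ⟨b, hbS, hbP⟩ :=
    combinatorial_nullstellensatz_exists_eval_nonzero P m₀ (mem_support_iff.1 hm₀) hdeg S hScard
  have hbn : ∀ i, ∃ n : ℕ, n ≤ m₀ i ∧ (n : K) = b i := fun i => by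
    obtain ⟨n, hn, hnb⟩ := Finset.mem_image.1 (hbS i)
    exact ⟨n, Nat.lt_succ_iff.1 (Finset.mem_range.1 hn), hnb⟩
  choose ℓ hℓle hℓb using hbn
  refine ⟨ℓ, fun i => ?_, ?_⟩
  · calc ℓ i ≤ m₀ i := hℓle i
      _ ≤ m₀.degree := by
        rw [Finsupp.degree_eq_sum]
        exact Finset.single_le_sum (fun j _ => Nat.zero_le _) (Finset.mem_univ i)
      _ = P.totalDegree := hdeg.symm
      _ ≤ V.card * (V.card - 1) := hPdeg
  · intro z hz z' hz' hzz'
    by_contra hne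
    have hp : (z, z') ∈ V.offDiag := Finset.mem_offDiag.2 ⟨hz, hz', hne⟩
    have hb : b = fun i => (ℓ i : K) := funext fun i => (hℓb i).symm
    apply hbP
    rw [hP, map_prod]
    refine Finset.prod_eq_zero hp ?_
    rw [hL, eval_linearFormPoly, hb]
    have : ∑ i, (z i - z' i) * (ℓ i : K) = ∑ i, (ℓ i : K) * z i - ∑ i, (ℓ i : K) * z' i := by
      rw [← Finset.sum_sub_distrib]
      exact Finset.sum_congr rfl fun i _ => by ring
    rw [this]
    exact sub_eq_zero.2 hzz'

end Literature.RingTheory.ZeroDimensional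

end
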